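import Literature.Computability.Complexity.PCP
import Literature.Computability.Complexity.CodeFPArith
import HarnessLib

/-!
# Padding the coins of a nonadaptive PCP verifier to an exact polynomial

Literature / complexity toolkit, companion of `PCP.lean` (`PCPVerifier`: `coins`, `queries`,
`decide`, `acceptProb`, `IsPolyTime`). Buhrman–Fortnow–Pavan's Lemma 3.7 is consumed in the tree
(`MetaComplexity/AvgCaseDerandomizationPCP.lean`) with verifiers run on EXACTLY `p(n)` coins for a
polynomial `p` (the convention of `PCPExact`, `PCPSubsetNP.lean`), while a concrete verifier uses a
computed number of coins `r(n) ≤ p(n)` (digits, block lengths, …). The remark "extra coins can be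
ignored" (Arora–Barak 2009, §7.1: the acceptance probability of an event depending only on a prefix
of the coin string is its probability over the prefix) is made into a construction with its
properties PROVED:

* `PCPVerifier.padCoins V P` — the verifier using `P n` coins that runs `V` on the first
  `V.coins n` of them; `accepts_padCoins`;
* **`acceptProb_padCoins`** — for `V.coins n ≤ P n` the acceptance probabilities agree (cylinder
  events, `uniformProb_take_of_le`);
* **`isPolyTime_padCoins`** — `padCoins V P` is polynomial time when `V` is, the coin count
  `x ↦ 1^{V.coins |x|}` is computed on codes (`CodeFP strE unE`), and `P` is polynomially bounded.

## References

* S. Arora, B. Barak, *Computational Complexity: A Modern Approach*, CUP 2009, §7.1 (coins of a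
  probabilistic machine; events depending on a prefix), Def. 11.4 [AroraBarakCC2009].
* H. Buhrman, L. Fortnow, A. Pavan, *Some results on derandomization*, Theory Comput. Syst. 38
  (2005), Thm. 3.3 / Lemma 3.7 (the consumer of exact-coin verifiers) [BuhrmanFortnowPavan2004].
-/

namespace Literature.Computability.Complexity

open _root_.Computability CodeFP

namespace PCPVerifier

/-- **The verifier with padded coins**: `P n` coins on inputs of length `n`, of which only the first
`V.coins n` are read. [cite: AroraBarakCC2009, §7.1] -/
def padCoins (V : PCPVerifier) (P : ℕ → ℕ) : PCPVerifier where
  coins := P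
  queries x ρ := V.queries x (ρ.take (V.coins x.length))
  decide x ρ a := V.decide x (ρ.take (V.coins x.length)) a

/-- Acceptance of the padded verifier is acceptance of `V` on the prefix. [folklore] -/
theorem accepts_padCoins (V : PCPVerifier) (P : ℕ → ℕ) (x : List Bool) (π : ℕ → Bool) (ρ : List Bool) :
    (V.padCoins P).accepts x π ρ = V.accepts x π (ρ.take (V.coins x.length)) := rfl

/-- **Padding preserves the acceptance probability** (when `V.coins n ≤ P n`). [cite: AroraBarakCC2009, §7.1] -/
theorem acceptProb_padCoins (V : PCPVerifier) {P : ℕ → ℕ} (hP : ∀ n, V.coins n ≤ P n) (x : List Bool) (π : ℕ → Bool) :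
    (V.padCoins P).acceptProb x π = V.acceptProb x π := by
  unfold acceptProb
  exact uniformProb_take_of_le (hP x.length) {ρ | V.accepts x π ρ = true}

/-- **Padding preserves polynomial time**, given the coin count of `V` as a unary numeral computed on
codes and a polynomial bound on `P`. [cite: AroraBarakCC2009, §7.1, Def. 11.4] -/
theorem isPolyTime_padCoins {V : PCPVerifier} (hV : V.IsPolyTime) (hc : CodeFP strE unE fun x => V.coins x.length)
    {P : ℕ → ℕ} (hP : ∃ p : Polynomial ℕ, ∀ n, P n ≤ p.eval n) : (V.padCoins P).IsPolyTime := by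
  obtain ⟨hq, hd, -⟩ := hV
  -- the recoders `(x, ρ) ↦ (x, ρ ↾ r)` and `(x, ρ, a) ↦ (x, ρ ↾ r, a)`, `r = V.coins |x|`
  have g1 : CodeFP (pairE strE strE) (pairE strE strE) (fun t => (t.1, t.2.take (V.coins t.1.length))) :=
    (CodeFP.fst _ _).pair (strTake.comp ((hc.comp (CodeFP.fst _ _)).pair (CodeFP.snd _ _)))
  have g2 : CodeFP (pairE strE (pairE strE strE)) (pairE strE (pairE strE strE))
      (fun t => (t.1, t.2.1.take (V.coins t.1.length), t.2.2)) :=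
    (CodeFP.fst _ _).pair ((strTake.comp ((hc.comp (CodeFP.fst _ _)).pair (CodeFP.snd _ _).fst')).pair (CodeFP.snd _ _).snd')
  refine ⟨?_, ?_, hP⟩
  · have h := PolyTimeComputable.comp_holds hq g1.polyTimeComputable
    exact h
  · have h := PolyTimeComputable.comp_holds hd g2.polyTimeComputable
    exact h

end PCPVerifier

end Literature.Computability.Complexity
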